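import Summits.ResolutionOfSingularities.ResolutionOfSingularities.Theorems.MarkedTransferCampaignW46GoodProcrastinationBudget
import Summits.ResolutionOfSingularities.ResolutionOfSingularities.Theorems.MarkedTransferCampaignW46ThreefoldsGammaFreeGlobalStrictTransform
import HarnessLib

/-!
# [OURS · L1 W4.6 rungs (i-h)/(i-i)] THE PHASE-0 INVARIANT `Δ(E)` AS A STATE FUNCTION: the total `δ`-invariant of the prime
# divisors of `V(J)` and its laws along §2.1-permissible surface steps (cell res-hironaka, LADDER-RESOLUTION rung L,
# D-0089; campaign s46, prover res-L1-s46-pv-1; host route MarkedTransfer, `--supports stmt-ResolutionOfSingularities-16155`)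

HONEST FRAMING. Nothing here is a statement of H. Hironaka's manuscript (2017-03-23, [Hironaka2017]) and nothing here
asserts that any statement of it holds. OURS objects over the tree's `δ`-invariant (`pointDelta`, Kollár 2007 §1.4) and
rung (ii-2)'s families (res-L1-s46-pv-11). AI-written; weaker than expert review. No `sorry`; axioms standard.

## What

The companions (`…GoodProcrastination` p539260, `…OurProcedure` p540391, `…UselessProcrastination` p542173) measure
PHASE 0 of OUR procedure by the total `δ`-invariant of SOME curve family presenting the prime divisors of `V(J)`
(`HasCurveFamily Z J n`). This file makes the measure a STATE FUNCTION and states its laws in the invariant idiom of rung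
(i-d) (p529691):

* `primeDivisorDelta η = Σ_c δ(𝒪_{C_η,c})` for the reduced curve `C_η = V(𝓘_{cl η})`, and
  **`curveDelta Z J = Σ_{η ∈ divisorialPoints J} primeDivisorDelta η ∈ ℕ∞`** — `Δ(J)`;
* `familyDelta_eq_curveDelta` — EVERY presenting family has total `δ`-invariant `Δ(J)` (members are isomorphic to the
  reduced curves on their images), so `HasCurveFamily Z J n ↔ n = Δ(J)` on surfaces (`hasCurveFamily_iff`);
* the LAWS on an ambient datum of dimension `≤ 2` with `E` standard: `Δ < ∞` (`curveDelta_ne_top`); **`Δ(E′) ≤ Δ(E)`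
  along every §2.1-permissible blow-up** (`curveDelta_transform_le`); **`Δ(E′) < Δ(E)` along a good procrastination**
  (`curveDelta_transform_lt_of_good`); and the budget `#{good procrastination stages} ≤ Δ(E₀)`
  (`PermissibleRun.card_goodProcrastinations_le_curveDelta`, from `…GoodProcrastinationBudget`).

## References

* J. Kollár, Lectures on Resolution of Singularities (2007), §1.4. [Kollar2007]
* H. Hironaka, ms. 2017-03-23, Th. 16.6 (2)/(3) p.84 (Eqs. (127)/(128): the ROLE of a decreasing invariant) — scope only,
  under adjudication, not cited as fact. [Hironaka2017]
-/

noncomputable section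

set_option linter.dupNamespace false -- mandated namespace of this single-conjunct summit

open CategoryTheory AlgebraicGeometry TopologicalSpace

namespace Summit.ResolutionOfSingularities.ResolutionOfSingularities.Theorems

namespace CampaignW46

open Literature.AlgebraicGeometry.Resolution
open Literature.AlgebraicGeometry.Hironaka2017.S02Preliminaries
open Literature.AlgebraicGeometry.Hironaka2017.Datum
open Scheme.IdealSheafData

universe u

variable {p : ℕ} [Fact p.Prime] {K : Type u} [Field K] [CharP K p]

/-! ## `Δ` as a state function -/

/-- [OURS · L1 W4.6] **`δ` of the prime divisor through `η`**: the total `δ`-invariant `Σ_c δ(𝒪_{C_η,c})` of the reduced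
closed subscheme `C_η = V(𝓘_{cl η})` (an integral scheme). [cite: Kollar2007, §1.4] -/
def primeDivisorDelta {Z : Scheme.{u}} (η : Z) : ℕ∞ :=
  haveI : IsIntegral (primeDivisorIdeal η).subscheme :=
    isIntegral_subscheme_vanishingIdeal _ isIrreducible_singleton.closure
  ∑ᶠ c, pointDelta (primeDivisorIdeal η).subscheme c

/-- [OURS · L1 W4.6] **THE PHASE-0 INVARIANT `Δ(J)`**: the sum of the `δ`-invariants of the prime divisors of `V(J)`
(its codimension-one points, `divisorialPoints J`). [cite: Kollar2007, §1.4] -/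
def curveDelta (Z : Scheme.{u}) (J : Z.IdealSheafData) : ℕ∞ :=
  ∑ᶠ η ∈ divisorialPoints J, primeDivisorDelta η

/-- A member of a curve family is isomorphic to the reduced curve on its image: same `Σδ`. [folklore] -/
theorem finsum_pointDelta_eq_primeDivisorDelta {Z C : Scheme.{u}} [IsIntegral C] (i : C ⟶ Z) [IsClosedImmersion i] :
    ∑ᶠ c, pointDelta C c = primeDivisorDelta (i (genericPoint C)) := by
  haveI : IsIntegral (primeDivisorIdeal (i (genericPoint C))).subscheme :=
    isIntegral_subscheme_vanishingIdeal _ isIrreducible_singleton.closure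
  have hker : (primeDivisorIdeal (i (genericPoint C))).subschemeι.ker = i.ker := by
    rw [ker_subschemeι, ker_eq_primeDivisorIdeal_of_isIntegral i]
  haveI := IsClosedImmersion.isIso_lift _ i hker
  exact (finsum_pointDelta_eq_of_isIso (IsClosedImmersion.lift _ i hker.le)).1

/-- **Every presenting family has total `δ`-invariant `Δ(J)`.** [cite: Kollar2007, §1.4] -/
theorem familyDelta_eq_curveDelta {Z : Scheme.{u}} {J : Z.IdealSheafData} {ι : Type} (ζ : ι → Z) (C : ι → Scheme.{u})
    (i : ∀ k, C k ⟶ Z) [∀ k, IsIntegral (C k)] [∀ k, IsClosedImmersion (i k)] (hζinj : Function.Injective ζ)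
    (hrange : Set.range ζ = divisorialPoints J) (hgen : ∀ k, i k (genericPoint (C k)) = ζ k) :
    familyDelta C = curveDelta Z J := by
  rw [familyDelta_def, curveDelta, ← hrange, finsum_mem_range hζinj]
  exact finsum_congr fun k => by rw [finsum_pointDelta_eq_primeDivisorDelta (i k), hgen k]

/-- `HasCurveFamily Z J n` pins `n = Δ(J)`. [folklore] -/
theorem HasCurveFamily.eq_curveDelta {Z : Scheme.{u}} {J : Z.IdealSheafData} {n : ℕ∞} (h : HasCurveFamily Z J n) :
    n = curveDelta Z J := by
  obtain ⟨ι, hι, ζ, C, i, hfam, hζinj, hrange, hn⟩ := h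
  haveI : ∀ k, IsIntegral (C k) := fun k => (hfam k).2.1
  haveI : ∀ k, IsClosedImmersion (i k) := fun k => (hfam k).1
  rw [← hn]
  exact familyDelta_eq_curveDelta ζ C i hζinj hrange fun k => (hfam k).2.2.2.2.2

/-- On a surface state, `HasCurveFamily Z J n ↔ n = Δ(J)`. [folklore] -/
theorem hasCurveFamily_iff (A : AmbientDatum p K) {E : IdealExponent A.Z} (hE : E.IsStandard)
    (hdimZ : topologicalKrullDim A.Z ≤ 2) (n : ℕ∞) : HasCurveFamily A.Z E.J n ↔ n = curveDelta A.Z E.J := by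
  constructor
  · exact HasCurveFamily.eq_curveDelta
  · rintro rfl
    obtain ⟨n, hF⟩ := exists_hasCurveFamily A hE hdimZ
    obtain rfl := hF.eq_curveDelta
    exact hF

/-! ## The laws of `Δ` -/

/-- **`Δ(E) < ∞`** on a surface state. [cite: Kollar2007, §1.4] -/
theorem curveDelta_ne_top (A : AmbientDatum p K) {E : IdealExponent A.Z} (hE : E.IsStandard)
    (hdimZ : topologicalKrullDim A.Z ≤ 2) : curveDelta A.Z E.J ≠ ⊤ := by
  obtain ⟨n, hF⟩ := exists_hasCurveFamily A hE hdimZ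
  rw [← hF.eq_curveDelta]
  exact hF.ne_top

/-- [OURS · L1 W4.6] NOT a statement of the manuscript. **LAW 1 — `Δ(E′) ≤ Δ(E)` along EVERY §2.1-permissible blow-up of
a standard surface state** (the Eq. (128)-type role: no increase). [cite: Kollar2007, §1.4] -/
theorem curveDelta_transform_le (A A' : AmbientDatum p K) (E : IdealExponent A.Z) (hE : E.IsStandard)
    (hdimZ : topologicalKrullDim A.Z ≤ 2) {D : Closeds A.Z} (hD : E.IsPermissibleCentre A.hom D) {π : A'.Z ⟶ A.Z}
    (hπ : IsBlowup π (vanishingIdeal D)) : curveDelta A'.Z (E.transform π D).J ≤ curveDelta A.Z E.J := by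
  obtain ⟨n, hF⟩ := exists_hasCurveFamily A hE hdimZ
  obtain ⟨n', hle, hF'⟩ := exists_hasCurveFamily_transform_le A A' E hE hdimZ hD hπ hF
  rw [← hF.eq_curveDelta, ← hF'.eq_curveDelta]
  exact hle

/-- [OURS · L1 W4.6] NOT a statement of the manuscript. **LAW 2 — `Δ(E′) < Δ(E)` along a GOOD PROCRASTINATION** (the
Eq. (127)-type role: strict decrease). [cite: Kollar2007, §1.4] -/
theorem curveDelta_transform_lt_of_good (A A' : AmbientDatum p K) (E : IdealExponent A.Z) (hE : E.IsStandard)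
    (hdimZ : topologicalKrullDim A.Z ≤ 2) {D : Closeds A.Z} (hgood : CentreGoodProcrastination E D)
    {π : A'.Z ⟶ A.Z} (hπ : IsBlowup π (vanishingIdeal D)) :
    curveDelta A'.Z (E.transform π D).J < curveDelta A.Z E.J := by
  obtain ⟨n, hF⟩ := exists_hasCurveFamily A hE hdimZ
  obtain ⟨n', hlt, hF'⟩ := exists_hasCurveFamily_transform_lt A A' E hE hdimZ hgood hπ hF
  rw [← hF.eq_curveDelta, ← hF'.eq_curveDelta]
  exact hlt

/-- [OURS · L1 W4.6] NOT a statement of the manuscript. **THE BUDGET, invariant form**: along a §2.1-permissible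
sequence with surface stages (any field, any universe), every finite set of good-procrastination stages has at most
`Δ(E₀)` elements. [cite: Kollar2007, §1.4] -/
theorem PermissibleRun.card_goodProcrastinations_le_curveDelta (r : PermissibleRun p K)
    (hdim : ∀ k, Regime.dimLE 2 (r.A k) (r.E k)) (s : Finset ℕ)
    (hs : ∀ k ∈ s, CentreGoodProcrastination (r.E k) (r.D k)) : (s.card : ℕ∞) ≤ curveDelta (r.A 0).Z (r.E 0).J :=
  r.card_goodProcrastinations_le hdim ((hasCurveFamily_iff (r.A 0) (r.standard 0) (hdim 0) _).mpr rfl) s hs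

end CampaignW46

end Summit.ResolutionOfSingularities.ResolutionOfSingularities.Theorems

end
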